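import Mathlib
import Summits.Ventures.FusionMHD.Models.SAlphaSecondStableS1A28PointCore
import HarnessLib

/-!
# F3 row «F3.BALLOON-sα-SECOND-STABILITY-S1-A28»: at `(s, α) = (1, 14/5)` — ABOVE the unstable band at shear `1` — the `s–α` ballooning MODEL is on the STABLE SIDE again (`SAlpha.StableSide (1) (14/5)`): the first kernel-certified SECOND-STABILITY point at shear `1` (small slacks `η_k = 1.0e-4 … 2.15e-4 < 1/T²`, core out to `T = 60`, tail constant `c = 25`); with gridfusion-lit-3's `Summit.Ventures.FusionMHD.Bench.SAlphaW25.unstableWitness_258` (`129/50 ∈ U_{1}`) the SECOND stability edge at `s = 1` lies in the CLOSED interval `[129/50, 14/5]` (width `11/50`)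

LADDER-GRIDFUSION rung F3 (cell `gridfusion`; DIRECTOR RULING 67 (5) + the director's class reading I4107 (2): the second stability edge is «a second
bracketed quantity per shear», booked on merits, no cap slot; ★ #284 «S3-SECOND-EDGE-BRACKET» is the `s = 3` instance).  Assembly by gridfusion-model-7 g10,
2026-08-28, in model-7 g8's multi-piece CORE LANE exactly as g9's `SAlphaSecondStableS3A6*` (generator HOME/models/model-7/g9/stable2/, design
`design36.py 1 2.8 <24 pieces on [0,60], slacks 1e-4+5e-6·k> 25 60`): (i) 24 kernel-certified core amplitude pieces `SAlphaSecondStableS1A28Core0…23` (polynomials `Y0…Y23` on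
`[0,1/2] ∪ [1/2,1] ∪ [1,3/2] ∪ [3/2,7/4] ∪ [7/4,2] ∪ [2,5/2] ∪ [5/2,3] ∪ [3,4] ∪ [4,6] ∪ [6,10] ∪ [10,14] ∪ [14,17] ∪ [17,20] ∪ [20,23] ∪ [23,26] ∪ [26,29] ∪ [29,32] ∪ [32,36] ∪ [36,40] ∪ [40,44] ∪ [44,48] ∪ [48,52] ∪ [52,56] ∪ [56,60]`, degrees ≤ 33, the first EVEN; Taylor-model POSITIVITY leaves of half-width `1/32` on `[0, 3]`, `1/16` beyond, deciding `F_k > 0` and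
`amplitudeResidual (1) (14/5) F_k F_k″ ≤ 0` piece by piece; slacks `η_k = 0.0001 … 0.000215` increasing to the right; trig point values with 20 terms after 5 halvings),
and (ii) gridfusion-lit-4's engine `Literature/MathematicalPhysics/MHD/BallooningSAlphaStableSide.lean` (`energyDominatesOn_of_amplitude`,
`EnergyDominatesOn.glue`, the explicit tail `(1 − c/θ)(1 + (α/s²) cos θ/θ²)` with `energyDominatesOn_tail` / `tail_logDeriv_le` at `(c, T) = (25, 60)` —
side condition `tailBound (1) (14/5) 25 60 ≥ 0` by `norm_num`; the junction `c/(T(T−c)) + (α/s²)(T+2)/(T(T²−α/s²)) = 0.01271… ≤ F′(60)/F(60) = 0.01303…`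
exact —, `stableSide_of_core_tail`).  The 28-statement program `ss128Prog` carries the shear; its top register is PROVED `= −amplitudeResidual (1) (14/5) F F″`.
All junctions and the tail junction are exact-rational inequalities; `F₀′(0) = 0` exactly.  0 kit in the kernel objects; no `native_decide`.
WHY SMALL SLACKS AND A LONG CORE (repair census): at `α/s² = 14/5 > 1` the Liouville potential changes sign every period, so the slack solution turns over once `η ≳ 1/θ²`; lit-4's tail majorant needs `T ≥ 43` for `c = 25` (`c = 20`: `T ≥ 60`) and the tail junction falls below the core's `F′/F` only near `T ≈ 60` (`0.01271 ≤ 0.01303`; g9 recorded (1, 3) as infeasible with slacks ≈ 1e-3 — «T ≥ 43»).  Trig point values: 20 terms after 7 halvings (`θ ≤ 60`).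

## THREE COLUMNS
CERTIFIED: in the `s–α` ballooning MODEL (Freidberg (12.96)–(12.99), `Λ = sθ − α sin θ`, `θ₀ = 0`) at `(s, α) = (1, 14/5)`: for EVERY window `[a, b]` and
every trial function `X` differentiable on `[a, b]` with `X(a) = X(b) = 0` there is NO `SAlpha.UnstableWitness` (`stableSide_one_28`) — the surface is on the
stable side although it lies ABOVE the certified-unstable surfaces of the same shear: with gridfusion-lit-3's `Summit.Ventures.FusionMHD.Bench.SAlphaW25.unstableWitness_258` (`(1, 129/50)` unstable)
the MODEL's SECOND stability boundary at `s = 1`, `sup {α ≤ 14/5 : α ∈ U_{1}}`, lies in the CLOSED interval `[129/50, 14/5]` (width `11/50`);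
monotonicity / connectedness of the unstable set in `α` is NOT typed.  VALIDATED (not in the kernel): float E–L shooting puts the second edge at
`α ≈ 2.6 (model-7 g9 band estimate (0.613, 2.6); lit-3's target 27/10)` for `s = 1` (lit-3 `edges.py` / model-7 g9 kit j304843); Freidberg Fig. 12.5 shows the second-stable region qualitatively; float
Liouville amplitude: `F′/F(60) ≈ 0.0130`, `min F ≈ 0.406`, slack margins `E/((1+Λ²)²F) ≤ −η_k`.  MODELLED: `s–α` model (large-aspect-ratio shifted circles,
high-`n` ballooning ordering, `θ₀ = 0`, ideal MHD); «stable side» = the MODEL's one-surface functional admits no negative compactly supported trial function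
(lit-3's witness class); the representation step (Connor–Hastie–Taylor 1979) is quoted in the Literature file, not typed; in particular NOTHING is claimed
about `θ₀ ≠ 0`, about a device, or about a `β`-limit.
Citations: Freidberg 2014 §12.3, §12.6.2 (12.96)–(12.100), Fig. 12.5 [Freidberg2014]; Hartman 2002 XI.6.2 [Hartman2002]; Makino–Berz 2003 Alg. 2
[MakinoBerz2003].  Everything below is [instance data].
-/

open Literature.Analysis.ValidatedNumerics Literature.Analysis.ValidatedNumerics.PolyMP
open Literature.Analysis.ValidatedNumerics.NumericsMP Literature.Analysis.ValidatedNumerics.ExpPoly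
open Literature.MathematicalPhysics.MHD.Ballooning
open Real Set

namespace Summit.Ventures.FusionMHD.Models

namespace SAlphaSecondStableS1A28

/-! (PART 5/5: §3b the main theorem; §1–§3a live in `SAlphaSecondStableS1A28PointPrep` / `PointPrep2` / `PointJunc` / `PointCore`.) -/

/-! ### §3 Assembly (main theorem) -/

/-- **THE ROW: `(s, α) = (1, 14/5)` IS ON THE STABLE SIDE OF THE `s–α` MODEL** — no window carries an `SAlpha.UnstableWitness`
(glued polynomial core on `[−60, 60]` by reflection, lit-4's explicit tail amplitude `(1 − c/θ)(1 + α cos θ/θ²)`, `c = 25`, beyond).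
MODEL `s–α`; «stable» in the model's own one-surface (Newcomb) sense; nothing about a device. [instance data] -/
theorem stableSide_one_28 : SAlpha.StableSide 1 (14 / 5) := by
  have hcore := ss128_dominates_core
  have htail := SAlpha.energyDominatesOn_tail (s := 1) (α := 14 / 5) (c := 25) (T := 60)
    (by norm_num) (by norm_num) (by norm_num) (by norm_num) (by norm_num) ss128_tailBound_nonneg
  refine SAlpha.stableSide_of_core_tail (by norm_num) hcore ?_ htail ?_
  · simp only [show ((0:ℝ) ≤ (1 / 2 : ℝ)) from by norm_num, show ((0:ℝ) ≤ (1 : ℝ)) from by norm_num, show ((0:ℝ) ≤ (3 / 2 : ℝ)) from by norm_num, show ((0:ℝ) ≤ (7 / 4 : ℝ)) from by norm_num, show ((0:ℝ) ≤ (2 : ℝ)) from by norm_num, show ((0:ℝ) ≤ (5 / 2 : ℝ)) from by norm_num, show ((0:ℝ) ≤ (3 : ℝ)) from by norm_num, show ((0:ℝ) ≤ (4 : ℝ)) from by norm_num, show ((0:ℝ) ≤ (6 : ℝ)) from by norm_num, show ((0:ℝ) ≤ (10 : ℝ)) from by norm_num, show ((0:ℝ) ≤ (14 : ℝ)) from by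 norm_num, show ((0:ℝ) ≤ (17 : ℝ)) from by norm_num, show ((0:ℝ) ≤ (20 : ℝ)) from by norm_num, show ((0:ℝ) ≤ (23 : ℝ)) from by norm_num, show ((0:ℝ) ≤ (26 : ℝ)) from by norm_num, show ((0:ℝ) ≤ (29 : ℝ)) from by norm_num, show ((0:ℝ) ≤ (32 : ℝ)) from by norm_num, show ((0:ℝ) ≤ (36 : ℝ)) from by norm_num, show ((0:ℝ) ≤ (40 : ℝ)) from by norm_num, show ((0:ℝ) ≤ (44 : ℝ)) from by norm_num, show ((0:ℝ) ≤ (48 : ℝ)) from by norm_num, show ((0:ℝ) ≤ (52 : ℝ)) from by norm_num, show ((0:ℝ) ≤ (56 : ℝ)) from by norm_num, if_true]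
    exact (SAlpha.amplitudePhase_zero_of_deriv_zero Y0d_at_zero.symm).le
  · have ht0 : ¬ ((60 : ℝ) ≤ (1 / 2 : ℝ)) := by norm_num
    have ht1 : ¬ ((60 : ℝ) ≤ (1 : ℝ)) := by norm_num
    have ht2 : ¬ ((60 : ℝ) ≤ (3 / 2 : ℝ)) := by norm_num
    have ht3 : ¬ ((60 : ℝ) ≤ (7 / 4 : ℝ)) := by norm_num
    have ht4 : ¬ ((60 : ℝ) ≤ (2 : ℝ)) := by norm_num
    have ht5 : ¬ ((60 : ℝ) ≤ (5 / 2 : ℝ)) := by norm_num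
    have ht6 : ¬ ((60 : ℝ) ≤ (3 : ℝ)) := by norm_num
    have ht7 : ¬ ((60 : ℝ) ≤ (4 : ℝ)) := by norm_num
    have ht8 : ¬ ((60 : ℝ) ≤ (6 : ℝ)) := by norm_num
    have ht9 : ¬ ((60 : ℝ) ≤ (10 : ℝ)) := by norm_num
    have ht10 : ¬ ((60 : ℝ) ≤ (14 : ℝ)) := by norm_num
    have ht11 : ¬ ((60 : ℝ) ≤ (17 : ℝ)) := by norm_num
    have ht12 : ¬ ((60 : ℝ) ≤ (20 : ℝ)) := by norm_num
    have ht13 : ¬ ((60 : ℝ) ≤ (23 : ℝ)) := by norm_num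
    have ht14 : ¬ ((60 : ℝ) ≤ (26 : ℝ)) := by norm_num
    have ht15 : ¬ ((60 : ℝ) ≤ (29 : ℝ)) := by norm_num
    have ht16 : ¬ ((60 : ℝ) ≤ (32 : ℝ)) := by norm_num
    have ht17 : ¬ ((60 : ℝ) ≤ (36 : ℝ)) := by norm_num
    have ht18 : ¬ ((60 : ℝ) ≤ (40 : ℝ)) := by norm_num
    have ht19 : ¬ ((60 : ℝ) ≤ (44 : ℝ)) := by norm_num
    have ht20 : ¬ ((60 : ℝ) ≤ (48 : ℝ)) := by norm_num
    have ht21 : ¬ ((60 : ℝ) ≤ (52 : ℝ)) := by norm_num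
    have ht22 : ¬ ((60 : ℝ) ≤ (56 : ℝ)) := by norm_num
    simp only [ht0, ht1, ht2, ht3, ht4, ht5, ht6, ht7, ht8, ht9, ht10, ht11, ht12, ht13, ht14, ht15, ht16, ht17, ht18, ht19, ht20, ht21, ht22, if_false]
    rw [SAlpha.amplitudePhase_le_iff]
    exact (SAlpha.tail_logDeriv_le (s := 1) (α := 14 / 5) (c := 25) (T := 60)
      (by norm_num) (by norm_num) (by norm_num) (by norm_num) (by norm_num)).trans ss128_junction_tail

/-- Corollary in lit-3's words: at `(s, α) = (1, 14/5)` there is no `SAlpha.UnstableWitness` on ANY window. [instance data] -/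
theorem not_unstableWitness_one_28 (a b : ℝ) (X X' : ℝ → ℝ) :
    ¬ SAlpha.UnstableWitness 1 (14 / 5) a b X X' :=
  stableSide_one_28 a b X X'

end SAlphaSecondStableS1A28

end Summit.Ventures.FusionMHD.Models
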